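import Summits.BirchSwinnertonDyer.Rank1Residual.WAll.AltClosersResidualCellsX1
import HarnessLib
import HarnessLib.Audit.Tags

/-!
# Rung W-ALL of ladder BSD (D-0120) — row 4 (corner X1) SLICED: the BALANCED rank-`0` slice, the
# UNBALANCED rank-`0` slice, the rank-`1` leaf (cell `bsd-wall`, lane (2); drafted by seat
# `bsd-wall-eis` g2 for the typing lane on director-bsd's order 2026-08-27T06:22:36Z)

HONEST FRAMING (cell `bsd-wall`, run/shared/lean/pub/bsd-wall/; brief `WALL-BRIEF-v1.md` sha16
b966bf16da27706e §2; tribunal-bsd round 1 on route `RealTwistEisenstein` = T1 FAIL «summit-strength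
(T1′ joint)», retarget ENDORSED by T1 + J: «closes_target := the BALANCED rank-0 X1 slice as a
registered leaf, NO residual»): STATEMENTS AND BOOKKEEPING ONLY — nothing asserted, nothing booked,
no named fact, no published theorem restated; each `@[conjecture] def` below is an OPEN obligation and
a SLICE of the registered row `Prop` `WAllCornerX1` of `Rank1Residual/WAll/Target.lean` (pattern of
`WAll/TargetPrimeSlices.lean`, p503270).

WHY THESE SLICES. Row 4 is `X1.RankZero.Statement ∧ X1.RankOne.Statement`
(`Rank1Residual.WAll.wallCornerX1_iff_x1Statements`, unconditional). The lane-3 route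
`RealTwistEisenstein` (Lecouturier–Wang real-quadratic Eisenstein criterion + supply) buys `BSD(E,p)`
PER PAIR on the BALANCED Mazur class of the rank-`0` leaf only — squarefree conductor, an isogenous
curve with rational `p`-torsion, `ord_p ∏ c_ℓ = 1` — through the double-twist certificate and
`X1.RankZeroDoubleTwistTransport.Leaf.bsdp_of_h308_of_doubleTwistPartnerAt` (`h308` + PUB). Its
round-1 cut (target the whole row, residual = the unbalanced slice in `BSD(E,p)` currency) was found
DEGENERATE by the tribunal (kernel certificate `residual_iff_s`: every admissible double twist of a
balanced pair is an UNBALANCED leaf pair — conductor exponent `2` at the primes of `d_{K'}` — and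
`BSD(E,p)` transports back, so the unbalanced slice + `h308` + PUB + BFH already carries the row).
The repair is to `--closes-target` the balanced slice BY NAME; a closed-rung leaf must be a
Theses-free `Prop`, hence this file. The balance predicate is INLINED VERBATIM in the shape the
route's cruxes `RealTwistEisensteinCriterion` / `RealTwistCriterionSupply` and the landed closers of
`WAll/AltClosersResidualCellsX1.lean` (binders `hBal` / `hUnb`) consume, so everything matches by `rfl`.

| slice `Prop` (this file) | shape |
|---|---|
| `WAllCornerX1RankZeroBalanced` | `X1.RankZero.Leaf W p → (Squarefree N(W) ∧ ∃ W' ∼ W, p ∣ #W'(ℚ)_tors ∧ ord_p ∏c_ℓ(W') = 1) → BSDp W p` |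
| `WAllCornerX1RankZeroUnbalanced` | `X1.RankZero.Leaf W p → ¬( … ) → BSDp W p` (= route item `UnbalancedRankZeroBSDp`, verbatim) |
| rank `1` | NOT RESTATED — it is `X1.RankOne.Statement` by name |

* §1 the two slice `Prop`s;
* §2 glue (no mathematics): `x1RankZeroStatement_iff_balanced_unbalanced`,
  `wAllCornerX1_iff_x1Slices` (row 4 ⟺ balanced ∧ unbalanced ∧ rank-one leaf),
  `x1Slices_of_wAllCornerX1`, `x1Slices_of_wAll` (registering the slices loses and adds nothing);
* §3 the closer of record for the balanced slice, BY NAME from the tree: `h308` (K5 crux 2, KY Thm.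
  3.0.8 IMC2 at `𝟙`, PRE) + the balanced CERTIFICATE cell + PUB ⇒ `WAllCornerX1RankZeroBalanced`
  (`wAllCornerX1RankZeroBalanced_of_h308_of_balancedCertificate`, one line over
  `X1.RankZeroDoubleTwistTransport.Leaf.bsdp_of_h308_of_doubleTwistPartnerAt`) — the shape the route's
  deciding theorem composes with its two cruxes. CONDITIONAL; nothing closed.

References: `WAll/Target.lean`, `WAll/TargetPrimeSlices.lean`, `WAll/AltClosersResidualCells.lean` §1,
`WAll/AltClosersResidualCellsX1.lean`; tribunal-bsd `route-BirchSwinnertonDyer-RealTwistEisenstein/t1.md`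
(RETARGET) and `verdict.slim.json` (retarget.endorsed); [cite: Miller2011LMS, §1 and Def. 1.1] (the
currency `BSD(E,p)`); [cite: Mazur1978, §6 Prop. 6.3 (1) (p. 153)] (a class-X1 pair is non-CM);
[claim: KellerYin2024, status: under-review] [cite: KellerYin2024, Thm. 3.0.8 (IMC2)].
-/

noncomputable section

open scoped Classical

open WeierstrassCurve Literature.NumberTheory.EllipticCurves
  Literature.NumberTheory.EllipticCurves.Rank1Residual Literature.NumberTheory.EllipticCurves.ModularForms
  Literature.NumberTheory.EllipticCurves.CastellaGrossiLeeSkinner2022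
  Literature.NumberTheory.EllipticCurves.KellerYin2024
open Summit.BirchSwinnertonDyer.Rank1Residual
open Summit.BirchSwinnertonDyer.Rank1Residual.X1.RankZeroDoubleTwist (DoubleTwistPartnerAt)

set_option autoImplicit false

namespace Summit.BirchSwinnertonDyer

/-! ### §1. Row 4, rank `0`, sliced by the balanced Mazur structure -/

/-- **Row 4, rank-`0` leaf, BALANCED slice (OPEN).** For every globally minimal elliptic `W/ℚ` and
prime `p` on the rank-`0` X1 leaf (`2 < p`, `E[p]` reducible, good anomalous, `r_an = 0`, off the
GV-parity quadrant) carrying the balanced Mazur structure — squarefree conductor and an isogenous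
globally minimal `W'` with `p ∣ #W'(ℚ)_tors` and `ord_p ∏_ℓ c_ℓ(W') = 1` — Miller's `BSD(E,p)`. The
`--closes-target` of route `RealTwistEisenstein` after the tribunal's round-1 retarget. [folklore] -/
@[conjecture] def WAllCornerX1RankZeroBalanced : Prop :=
  ∀ (W : WeierstrassCurve ℚ) [W.IsElliptic] [W.IsGloballyMinimal] (p : ℕ) [Fact p.Prime],
    X1.RankZero.Leaf W p →
    (Squarefree (W.conductorNorm ℤ) ∧
      ∃ (W' : WeierstrassCurve ℚ) (_ : W'.IsElliptic) (_ : W'.IsGloballyMinimal),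
        IsIsogenous W W' ∧ p ∣ W'.torsionOrder ∧ padicValNat p W'.tamagawaProduct = 1) →
    BSDp W p

/-- **Row 4, rank-`0` leaf, UNBALANCED slice (OPEN)** — the complement: no balanced structure
(conductor not squarefree, or no isogenous curve with rational `p`-torsion and `ord_p ∏c_ℓ = 1`).
Verbatim the route item `RealTwistEisenstein.UnbalancedRankZeroBSDp` and the binder `hUnb` of
`Rank1Residual.WAll.x1RankZeroStatement_of_h308_of_balancedCertificate_of_unbalancedBSDp`. It
contains every admissible double twist of a balanced pair (tribunal-bsd RTE round 1). [folklore] -/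
@[conjecture] def WAllCornerX1RankZeroUnbalanced : Prop :=
  ∀ (W : WeierstrassCurve ℚ) [W.IsElliptic] [W.IsGloballyMinimal] (p : ℕ) [Fact p.Prime],
    X1.RankZero.Leaf W p →
    ¬ (Squarefree (W.conductorNorm ℤ) ∧
      ∃ (W' : WeierstrassCurve ℚ) (_ : W'.IsElliptic) (_ : W'.IsGloballyMinimal),
        IsIsogenous W W' ∧ p ∣ W'.torsionOrder ∧ padicValNat p W'.tamagawaProduct = 1) →
    BSDp W p

/-! ### §2. Glue: row 4 is EXACTLY balanced ∧ unbalanced ∧ the rank-one leaf (no mathematics) -/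

/-- The rank-`0` leaf statement (ladder row A3) ⟺ its balanced slice ∧ its unbalanced slice
(excluded middle on the balance predicate). [folklore] -/
theorem x1RankZeroStatement_iff_balanced_unbalanced :
    X1.RankZero.Statement ↔ WAllCornerX1RankZeroBalanced ∧ WAllCornerX1RankZeroUnbalanced := by
  constructor
  · intro h
    exact ⟨fun W _ _ p _ hL _ ↦ h W p hL, fun W _ _ p _ hL _ ↦ h W p hL⟩
  · rintro ⟨hB, hU⟩ W _ _ p _ hL
    by_cases hb : (Squarefree (W.conductorNorm ℤ) ∧
        ∃ (W' : WeierstrassCurve ℚ) (_ : W'.IsElliptic) (_ : W'.IsGloballyMinimal),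
          IsIsogenous W W' ∧ p ∣ W'.torsionOrder ∧ padicValNat p W'.tamagawaProduct = 1)
    · exact hB W p hL hb
    · exact hU W p hL hb

/-- **Row 4 ⟺ balanced rank-`0` slice ∧ unbalanced rank-`0` slice ∧ rank-`1` leaf statement**
(`Rank1Residual.WAll.wallCornerX1_iff_x1Statements` — a class-X1 pair is non-CM — then §2's split).
[cite: Mazur1978, §6 Prop. 6.3 (1) (p. 153)] -/
theorem wAllCornerX1_iff_x1Slices :
    WAllCornerX1 ↔
      WAllCornerX1RankZeroBalanced ∧ WAllCornerX1RankZeroUnbalanced ∧ X1.RankOne.Statement := by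
  rw [Rank1Residual.WAll.wallCornerX1_iff_x1Statements, x1RankZeroStatement_iff_balanced_unbalanced,
    and_assoc]

/-- The three slices reassemble row 4 (bookkeeping summary of `wAllCornerX1_iff_x1Slices`). [folklore] -/
theorem wAllCornerX1_of_x1Slices (hB : WAllCornerX1RankZeroBalanced)
    (hU : WAllCornerX1RankZeroUnbalanced) (h1 : X1.RankOne.Statement) : WAllCornerX1 :=
  wAllCornerX1_iff_x1Slices.mpr ⟨hB, hU, h1⟩

/-- Every slice follows from row 4 (each is an instance of it). [cite: Mazur1978, §6 Prop. 6.3 (1) (p. 153)] -/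
theorem x1Slices_of_wAllCornerX1 (h : WAllCornerX1) :
    WAllCornerX1RankZeroBalanced ∧ WAllCornerX1RankZeroUnbalanced ∧ X1.RankOne.Statement :=
  wAllCornerX1_iff_x1Slices.mp h

/-- … and from `WAll` (so registering the slices loses and adds nothing). [folklore] -/
theorem x1Slices_of_wAll (h : WAll) :
    WAllCornerX1RankZeroBalanced ∧ WAllCornerX1RankZeroUnbalanced ∧ X1.RankOne.Statement :=
  ⟨fun W _ _ p _ hL _ ↦ h W p (by have h0 := hL.2; omega),
    fun W _ _ p _ hL _ ↦ h W p (by have h0 := hL.2; omega),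
    fun W _ _ p _ hL ↦ h W p (by have h1 := hL.2; omega)⟩

/-! ### §3. The closer of record for the balanced slice, BY NAME (conditional; nothing closed) -/

/-- **The balanced rank-`0` slice from `h308` + the BALANCED CERTIFICATE cell + PUB.** On a balanced
leaf pair the double-twist certificate `DoubleTwistPartnerAt W p` gives `BSD(E,p)` per pair by
`X1.RankZeroDoubleTwistTransport.Leaf.bsdp_of_h308_of_doubleTwistPartnerAt` (Ribet's lemma supplies
the good lattice; KY Thm. 3.0.8 (IMC2) at `𝟙` for it = `h308`, PRE; CGLS 5.1.1, Wuthrich Prop. 21,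
Cassels, modularity, Gross–Zagier, Kolyvagin, GZK published). This is the shape route
`RealTwistEisenstein`'s deciding theorem composes with its two cruxes (criterion ∧ supply ⇒ the
certificate cell on the balanced class). CONDITIONAL; nothing closed. [claim: KellerYin2024, status: under-review]
[cite: KellerYin2024, Thm. 3.0.8 (IMC2), Prop. 1.3.1] [cite: Ribet1976, Prop. 2.1]
[cite: Wuthrich2014, Prop. 21 (p. 400)] -/
theorem wAllCornerX1RankZeroBalanced_of_h308_of_balancedCertificate
    (h308 : thm308_imc2_bdpValue_goodLattice_OPEN)
    (hBal : ∀ (W : WeierstrassCurve ℚ) [W.IsElliptic] [W.IsGloballyMinimal] (p : ℕ) [Fact p.Prime],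
      X1.RankZero.Leaf W p →
      (Squarefree (W.conductorNorm ℤ) ∧
        ∃ (W' : WeierstrassCurve ℚ) (_ : W'.IsElliptic) (_ : W'.IsGloballyMinimal),
          IsIsogenous W W' ∧ p ∣ W'.torsionOrder ∧ padicValNat p W'.tamagawaProduct = 1) →
      DoubleTwistPartnerAt W p)
    (h511 : thm511_anticyclotomicControl_of_torsionFree)
    (hW : Wuthrich2014.sha_dvd_analyticSha) (hCassels : bsdRHS_eq_of_isIsogenous)
    (hmodP : nonempty_modularParametrizationData) (hmod : exists_isNewformOf)
    (hGZQ : GrossZagier1986_thm_I_7_3)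
    (hGZ : ∀ (N : ℕ) [NeZero N] (W : WeierstrassCurve ℚ) (K : Type) [Field K] [NumberField K],
      gross_zagier N W K)
    (hKo : ∀ (N : ℕ) [NeZero N] (W : WeierstrassCurve ℚ) (K : Type) [Field K] [NumberField K],
      kolyvagin N W K)
    (hGZK : rank_eq_analyticRank_of_analyticRank_le_one) : WAllCornerX1RankZeroBalanced :=
  fun V _ _ p _ hL hB ↦
    X1.RankZeroDoubleTwistTransport.Leaf.bsdp_of_h308_of_doubleTwistPartnerAt h308 h511 hW hCassels
      hmodP hmod hGZQ hGZ hKo hGZK V hL (hBal V p hL hB)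

/-- **The unbalanced slice is the route item's statement and a slice of K5's X1 conjunct**
(`Rank1Residual.WAll.unbalancedRankZeroBSDp_of_bsdpOnClassX1`, by name). [folklore] -/
theorem wAllCornerX1RankZeroUnbalanced_of_bsdpOnClassX1
    (h : BirchSwinnertonDyer.Theorems.Rank1ResidualX1Defs.BSDpOnClassX1) :
    WAllCornerX1RankZeroUnbalanced :=
  Rank1Residual.WAll.unbalancedRankZeroBSDp_of_bsdpOnClassX1 h

end Summit.BirchSwinnertonDyer

end
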